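import Mathlib
import Summits.Schanuel.Schanuel.Theses.RigidCore
import Summits.Schanuel.Schanuel.Theorems.RigidCoreMinimalCounterexampleInAclResidues
import Summits.Schanuel.Schanuel.Theorems.RigidCoreMinimalCounterexampleInAclMixedBridge

/-!
# The rank-2 residue of (S*) is PURE sparsity — crux stmt-Schanuel-0969 `RigidCore.MinimalCounterexampleInAcl`

Route `RigidCore`, crux (S*) `MinimalCounterexampleInAcl` (item stmt-Schanuel-0969), line `kernel-arithmetic-selection`
(lead prover-line-stmt-Schanuel-0969-c4-0), `--supports stmt-Schanuel-0969`; registered stubs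
`pureSparsityTwo_iff_pure_locusMates_finite` and `stub_rankTwo_pureExp_of_pureSparsityTwo`.

After the log sector (every rank, `stub_cruxLogSector`) and the mixed sector at rank 2 (`stub_rankTwo_mixedSector`,
acl-membership WITHOUT finiteness) the only open part of (S*) at rank 2 is the PURE EXPONENTIAL SECTOR: first failures
`x : Fin 2 → ℂ` such that `e^{Σ Mᵢxᵢ}` is transcendental for every non-zero `M : Fin 2 → ℤ` (registered residue
`stub_rankTwo_pureExp`).  This file identifies the sparsity statement that residue needs.  Call a ℚ-linearly independent
`x` PURE when no non-zero integer combination of `x` has an algebraic exponential, and let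

  `PureSparsityTwo` := every `W ⊆ ℂ² × ℂ²` defined over `ℚ` with `zariskiDim ℂ W < 2` carries finitely many
  ℚ-linearly independent PURE graph points `(x, eˣ)`

(spelled inline below; it is `SparsityTwo` (crux stmt-Schanuel-0971) restricted to pure points, `sparsityTwo_imp_pureSparsityTwo`).

* `pure_of_mem_locusMates`: purity is an invariant of the mate class of a first failure (mates have the same relation
  ideal, `mate_firstFailure_voc`, and algebraicity of `e^{Σ Mᵢxᵢ}` is a ℚ-polynomial relation of `(x, eˣ)` after
  homogenisation, `aeval_expPoint_homogenised`).
* `pureSparsityTwo_iff_pure_locusMates_finite`: `PureSparsityTwo` ⟺ every PURE rank-2 first failure has finitely many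
  mates (→: the mates lie on the ℚ-curve of `x` and are pure; ←: relation ideals of independent points of `W = Z(J)` are
  minimal primes over `J`, finitely many, and a fibre of `x ↦ P_x` through a pure point is inside one pure mate set —
  the proof of `sparsityTwo_iff_rankTwo_locusMates_finite` restricted to pure points).
* `stub_rankTwo_pureExp_of_pureSparsityTwo`: `PureSparsityTwo` ⟹ the registered residue `stub_rankTwo_pureExp`
  (definable isolation is free, `coord_mem_expAcl_of_sparsity`).

So (S*)₂ needs strictly fewer atoms than `SparsityTwo`: of the three kernel-checked open instances of crux 0971
(`Cruxes/SparsityTwo/Disproof.lean` §3), the flagship root-chain curve §3a `{x₂ = x₁³, y₂ = 1, (1−x₁)(y₁+1) = 2}` is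
MIXED (`y₂ = 1`) and is irrelevant for (S*) (covered by the mixed sector), while §3b (double-Cayley cubic) and §3c
(slope ∛2) are pure and remain.
-/

noncomputable section

set_option linter.dupNamespace false

open Complex Set
open Literature.NumberTheory.Transcendental

namespace Summit.Schanuel.Schanuel.Cruxes.MinimalCounterexampleInAcl.KernelArithmeticSelection

open Summit.Schanuel.Schanuel.Theorems
open Summit.Schanuel.Schanuel.Theorems.AclSubsetLogFreeCore.Negative

variable {n : ℕ}

/-! ## Purity is a mate-class invariant -/

/-- Algebraicity of `e^{Σ Mᵢxᵢ}` passes to every point satisfying the ℚ-relations of `(x, eˣ)`: the homogenised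
annihilating polynomial is such a relation. [folklore] -/
theorem isAlgebraic_cexp_intCombo_of_mem_locusPts {x x' : Fin n → ℂ} (M : Fin n → ℤ) (hx' : x' ∈ locusPts x)
    (halg : IsAlgebraic ℚ (cexp (∑ i, (M i : ℂ) * x i))) :
    IsAlgebraic ℚ (cexp (∑ i, (M i : ℂ) * x' i)) := by
  obtain ⟨p, hp0, hpx⟩ := halg
  have hN : ∀ z : Fin n → ℂ, (∏ i, cexp (z i) ^ (-M i).toNat) ^ p.natDegree ≠ 0 := fun z =>
    pow_ne_zero _ (Finset.prod_ne_zero_iff.2 fun i _ => pow_ne_zero _ (Complex.exp_ne_zero _))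
  refine ⟨p, hp0, ?_⟩
  have hRx := aeval_expPoint_homogenised p le_rfl M x
  rw [hpx, mul_zero] at hRx
  have h := hx' _ hRx
  rw [aeval_expPoint_homogenised p le_rfl M x'] at h
  exact (mul_eq_zero.1 h).resolve_left (hN x')

/-- A tuple satisfies its own relations. [folklore] -/
theorem self_mem_locusPts (x : Fin n → ℂ) : x ∈ locusPts x := fun _ hp => hp

/-- **Purity is an invariant of the mate class of a first failure**: if no non-zero integer combination of the first
failure `x` has an algebraic exponential, the same holds for every mate `x'` of `x` (the relation sets of `x` and `x'`
coincide, `mate_firstFailure_voc`). [folklore] -/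
theorem pure_of_mem_locusMates {x x' : Fin n → ℂ} (hx : x ∈ firstFailures n) (hx' : x' ∈ locusMates x)
    (hpure : ∀ M : Fin n → ℤ, M ≠ 0 → Transcendental ℚ (cexp (∑ i, (M i : ℂ) * x i))) :
    ∀ M : Fin n → ℤ, M ≠ 0 → Transcendental ℚ (cexp (∑ i, (M i : ℂ) * x' i)) := by
  intro M hM halg
  have heq : locusPts x' = locusPts x := (mate_firstFailure_voc hx hx').2
  have hxx' : x ∈ locusPts x' := by rw [heq]; exact self_mem_locusPts x
  exact hpure M hM (isAlgebraic_cexp_intCombo_of_mem_locusPts M hxx' halg)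

/-! ## `PureSparsityTwo` ⟹ finiteness of the mates of pure rank-2 first failures -/

/-- `SparsityTwo` (crux stmt-Schanuel-0971) implies its restriction to pure points. [folklore] -/
theorem sparsityTwo_imp_pureSparsityTwo (hSp : Summit.Schanuel.Schanuel.Theses.RigidCore.SparsityTwo) :
    ∀ W : Set (Fin 2 ⊕ Fin 2 → ℂ), IsDefinedOver (⊥ : Subfield ℂ) W → zariskiDim ℂ W < 2 →
      Set.Finite {x : Fin 2 → ℂ | LinearIndependent ℚ x ∧ Sum.elim x (cexp ∘ x) ∈ W ∧
        ∀ M : Fin 2 → ℤ, M ≠ 0 → Transcendental ℚ (cexp (∑ i, (M i : ℂ) * x i))} :=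
  fun W hW hd => (hSp W hW hd).subset fun _ hx => ⟨hx.1, hx.2.1⟩

/-- **`PureSparsityTwo` gives finiteness of the mate set of every PURE rank-2 first failure**: `(x, eˣ)` lies on a
ℚ-curve `W` of dimension `< 2`, every mate lies on the same `W` and is pure. [folklore] -/
theorem pure_locusMates_finite_of_pureSparsityTwo
    (hPSp : ∀ W : Set (Fin 2 ⊕ Fin 2 → ℂ), IsDefinedOver (⊥ : Subfield ℂ) W → zariskiDim ℂ W < 2 →
      Set.Finite {x : Fin 2 → ℂ | LinearIndependent ℚ x ∧ Sum.elim x (cexp ∘ x) ∈ W ∧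
        ∀ M : Fin 2 → ℤ, M ≠ 0 → Transcendental ℚ (cexp (∑ i, (M i : ℂ) * x i))})
    {x : Fin 2 → ℂ} (hx : x ∈ firstFailures 2)
    (hpure : ∀ M : Fin 2 → ℤ, M ≠ 0 → Transcendental ℚ (cexp (∑ i, (M i : ℂ) * x i))) :
    (locusMates x).Finite := by
  obtain ⟨W, hW, hd, hxW⟩ := exists_mem_indepExpPoints_of_trdeg_lt_two hx.1 (by exact_mod_cast hx.2.1)
  refine (hPSp W hW hd).subset ?_
  intro x' hx'
  exact ⟨hx'.1, mem_of_isDefinedOver_bot_of_relations hW hxW.2 hx'.2, pure_of_mem_locusMates hx hx' hpure⟩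

/-! ## Finiteness of the mates of pure rank-2 first failures ⟹ `PureSparsityTwo` -/

/-- **Finiteness of the mate sets of PURE rank-2 first failures gives `PureSparsityTwo`.** The relation ideals of the
independent exponential points of `W = Z(I)` are minimal primes over the ℚ-ideal of `W` — finitely many — and each fibre
of `x ↦ P_x` through a pure point lies in one (finite) pure mate set. [cite: GortzWedhorn2020, Prop. 5.38] -/
theorem pureIndepExpPoints_finite_of_pure_locusMates_finite
    (hfin : ∀ x : Fin 2 → ℂ, x ∈ firstFailures 2 →
      (∀ M : Fin 2 → ℤ, M ≠ 0 → Transcendental ℚ (cexp (∑ i, (M i : ℂ) * x i))) → (locusMates x).Finite)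
    (W : Set (Fin 2 ⊕ Fin 2 → ℂ)) (hW : IsDefinedOver (⊥ : Subfield ℂ) W) (hd : zariskiDim ℂ W < 2) :
    Set.Finite {x : Fin 2 → ℂ | LinearIndependent ℚ x ∧ Sum.elim x (cexp ∘ x) ∈ W ∧
      ∀ M : Fin 2 → ℤ, M ≠ 0 → Transcendental ℚ (cexp (∑ i, (M i : ℂ) * x i))} := by
  classical
  obtain ⟨I, hI⟩ := hW
  -- the `ℚ`-ideal of `W`
  set J : Ideal (MvPolynomial (Fin 2 ⊕ Fin 2) ℚ) := I.comap (MvPolynomial.map ratToBot) with hJ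
  have hWJ : W = MvPolynomial.zeroLocus ℂ J := by
    rw [hI]
    ext w
    simp only [MvPolynomial.mem_zeroLocus_iff]
    constructor
    · intro h g hg
      have := h _ (Ideal.mem_comap.1 hg)
      rwa [aeval_map_ratToBot] at this
    · intro h f hf
      obtain ⟨g, rfl⟩ := MvPolynomial.map_surjective ratToBot ratToBot_surjective f
      rw [aeval_map_ratToBot]
      exact h g (Ideal.mem_comap.2 hf)
  have hdimJ : ringKrullDim (MvPolynomial (Fin 2 ⊕ Fin 2) ℂ ⧸
      MvPolynomial.vanishingIdeal ℂ (MvPolynomial.zeroLocus ℂ J)) ≤ 1 := by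
    have h : zariskiDim ℂ (MvPolynomial.zeroLocus ℂ J) < 2 := by rwa [← hWJ]
    exact withBot_enat_le_one_of_lt_two h
  -- the relation ideal of a point
  let P : (Fin 2 → ℂ) → Ideal (MvPolynomial (Fin 2 ⊕ Fin 2) ℚ) := fun x =>
    RingHom.ker (MvPolynomial.aeval (Sum.elim x (cexp ∘ x)) : MvPolynomial (Fin 2 ⊕ Fin 2) ℚ →ₐ[ℚ] ℂ)
  set S : Set (Fin 2 → ℂ) := {x : Fin 2 → ℂ | LinearIndependent ℚ x ∧ Sum.elim x (cexp ∘ x) ∈ W ∧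
    ∀ M : Fin 2 → ℤ, M ≠ 0 → Transcendental ℚ (cexp (∑ i, (M i : ℂ) * x i))} with hS
  -- relation ideals of points of `S` are minimal primes over `J`
  have hmin : ∀ x ∈ S, P x ∈ J.minimalPrimes := by
    rintro x ⟨hx, hxW, -⟩
    rw [hWJ, MvPolynomial.mem_zeroLocus_iff] at hxW
    obtain ⟨i, hi⟩ := exists_transcendental_coord hx
    exact ker_aeval_mem_minimalPrimes J hdimJ hxW hi
  have hfinmin : J.minimalPrimes.Finite := Ideal.finite_minimalPrimes_of_isNoetherianRing _ J
  -- `S` is the union over the minimal primes of the fibres of `P`, each inside one pure mate set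
  refine (hfinmin.biUnion (t := fun 𝔭 => {x ∈ S | P x = 𝔭}) ?_).subset ?_
  · intro 𝔭 _
    by_cases hne : ({x ∈ S | P x = 𝔭} : Set (Fin 2 → ℂ)).Nonempty
    · obtain ⟨x₀, hx₀S, hx₀P⟩ := hne
      have hff : x₀ ∈ firstFailures 2 := mem_firstFailures_two_of_mem ⟨I, hI⟩ hd hx₀S.1 hx₀S.2.1
      refine (hfin x₀ hff hx₀S.2.2).subset ?_
      rintro x' ⟨hx'S, hx'P⟩
      refine mem_locusMates_of_ker_le hx'S.1 ?_
      change P x₀ ≤ P x'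
      rw [hx₀P, hx'P]
    · rw [Set.not_nonempty_iff_eq_empty.1 hne]
      exact Set.finite_empty
  · intro x hx
    exact Set.mem_iUnion₂.2 ⟨P x, hmin x hx, hx, rfl⟩

/-! ## The registered stubs -/

/-- **Registered stub `pureSparsityTwo_iff_pure_locusMates_finite` (PROVED): `PureSparsityTwo` — finiteness of the
ℚ-linearly independent PURE graph points of every ℚ-curve of `ℂ² × ℂ²` — is EQUIVALENT to finiteness of the mate set of
every pure rank-2 first failure.**  This is the sparsity input the rank-2 residue `stub_rankTwo_pureExp` of (S*) needs;
it is `SparsityTwo` (crux stmt-Schanuel-0971) minus its mixed curves. [cite: GortzWedhorn2020, Prop. 5.38] -/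
theorem pureSparsityTwo_iff_pure_locusMates_finite : (∀ W : Set (Fin 2 ⊕ Fin 2 → ℂ), Literature.NumberTheory.Transcendental.IsDefinedOver (⊥ : Subfield ℂ) W → Literature.NumberTheory.Transcendental.zariskiDim ℂ W < 2 → Set.Finite {x : Fin 2 → ℂ | LinearIndependent ℚ x ∧ Sum.elim x (Complex.exp ∘ x) ∈ W ∧ ∀ M : Fin 2 → ℤ, M ≠ 0 → Transcendental ℚ (Complex.exp (∑ i, (M i : ℂ) * x i))}) ↔ ∀ x : Fin 2 → ℂ, x ∈ Summit.Schanuel.Schanuel.Cruxes.MinimalCounterexampleInAcl.KernelArithmeticSelection.firstFailures 2 → (∀ M : Fin 2 → ℤ, M ≠ 0 → Transcendental ℚ (Complex.exp (∑ i, (M i : ℂ) * x i))) → (Summit.Schanuel.Schanuel.Cruxes.MinimalCounterexampleInAcl.KernelArithmeticSelection.locusMates x).Finite := by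
  constructor
  · intro hPSp x hx hpure
    exact pure_locusMates_finite_of_pureSparsityTwo hPSp hx hpure
  · intro hfin W hW hd
    exact pureIndepExpPoints_finite_of_pure_locusMates_finite hfin W hW hd

/-- **Registered stub `stub_rankTwo_pureExp_of_pureSparsityTwo` (PROVED): `PureSparsityTwo` implies the rank-2 pure
exponential residue `stub_rankTwo_pureExp` of (S*)** — the mates of a pure first failure are finitely many and definable
isolation is free (`coord_mem_expAcl_of_sparsity`). [folklore] -/
theorem stub_rankTwo_pureExp_of_pureSparsityTwo : (∀ W : Set (Fin 2 ⊕ Fin 2 → ℂ), Literature.NumberTheory.Transcendental.IsDefinedOver (⊥ : Subfield ℂ) W → Literature.NumberTheory.Transcendental.zariskiDim ℂ W < 2 → Set.Finite {x : Fin 2 → ℂ | LinearIndependent ℚ x ∧ Sum.elim x (Complex.exp ∘ x) ∈ W ∧ ∀ M : Fin 2 → ℤ, M ≠ 0 → Transcendental ℚ (Complex.exp (∑ i, (M i : ℂ) * x i))}) → ∀ (x : Fin 2 → ℂ), x ∈ Summit.Schanuel.Schanuel.Cruxes.MinimalCounterexampleInAcl.KernelArithmeticSelection.firstFailures 2 →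 (∀ M : Fin 2 → ℤ, M ≠ 0 → Transcendental ℚ (Complex.exp (∑ i, (M i : ℂ) * x i))) → ∀ i, x i ∈ Summit.Schanuel.Schanuel.Theorems.AclSubsetLogFreeCore.Negative.expAcl := by
  intro hPSp x hx hpure i
  exact coord_mem_expAcl_of_sparsity hx (pure_locusMates_finite_of_pureSparsityTwo hPSp hx hpure) i

/-- **The pure residue from mate finiteness, in the crux's own vocabulary**: if every pure rank-2 first failure has a
finite mate set then every coordinate of every pure rank-2 first failure lies in a finite `∅`-definable subset of `ℂ_exp`.
[folklore] -/
theorem rankTwo_pureExp_of_pure_locusMates_finite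
    (hfin : ∀ x : Fin 2 → ℂ, x ∈ firstFailures 2 →
      (∀ M : Fin 2 → ℤ, M ≠ 0 → Transcendental ℚ (cexp (∑ i, (M i : ℂ) * x i))) → (locusMates x).Finite)
    {x : Fin 2 → ℂ} (hx : x ∈ firstFailures 2)
    (hpure : ∀ M : Fin 2 → ℤ, M ≠ 0 → Transcendental ℚ (cexp (∑ i, (M i : ℂ) * x i))) (i : Fin 2) :
    x i ∈ expAcl :=
  coord_mem_expAcl_of_sparsity hx (hfin x hx hpure) i

end Summit.Schanuel.Schanuel.Cruxes.MinimalCounterexampleInAcl.KernelArithmeticSelection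

end
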